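import Literature.NumberTheory.DiophantineGeometry.PowerTraceStabilizer
import Literature.NumberTheory.DiophantineGeometry.SymmetricSliceCharacter
import HarnessLib

/-!
# BLMW's symmetric Kronecker bound for the determinant orbit closure:
# `mult_{λ*} k[Δ(det_m)]_d ≤ sk(λ, m × d)` (proved)

Bürgisser–Landsberg–Manivel–Weyman, *An overview of mathematical issues arising in the geometric
complexity theory approach to VP ≠ VNP*, SIAM J. Comput. 40(4) (2011) 1179–1209, §5.2 define the
*symmetric Kronecker coefficient* "`sk^π_{μμ} := dim Hom_{𝔖_d}([π], Sym²[μ])`. So `sk^π_{μμ}`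
equals the multiplicity of `[π]` in the symmetric square `Sym²[μ]`. Note that `sk^π_{μμ} ≤ k_{πμμ}`
and the inequality may be strict" ((5.2.5)) and prove (Prop. 5.2.1, (5.2.6)–(5.2.7))
"`ℂ[GL(W)·det_n] = ⊕_{δ ≥ 0} ⊕_{π : |π| = nδ} (S_πW^*)^{⊕ sk^π_{δⁿδⁿ}}`,
`ℂ[\overline{GL(W)·det_n}]_δ ⊆ ⊕_{π : |π| = nδ} (S_πW^*)^{⊕ sk^π_{δⁿδⁿ}}`": the stabilizer of
`det_n` in `GL(E ⊗ F)` is `H = H₀ ⋊ ℤ₂`, `H₀ = S(GL(E) × GL(F))`, the `ℤ₂` generated by the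
transposition `τ`, and "by (le:tau-action) the action of the involution `τ` corresponds to the
action of `σ^π_{δⁿδⁿ}` on `K^π_{δⁿ,δⁿ}`. Therefore `dim (S_π(E ⊗ F))^H = sk^π_{δⁿδⁿ}`".

The sibling file `SchurWeylPlethysmKroneckerBoundProofs` proves the weaker bound by the full
Kronecker coefficient `k_{π δⁿ δⁿ} = g(λ, m × d, m × d)` (`orbitMultiplicity_det_le_kroneckerCoeff_holds`),
using only the subgroup `H₀` (indeed only its pairs of unimodular upper triangular matrices). This
file adds the transposition, exactly as in BLMW's proof, and proves the sharper bound

* `orbitMultiplicity_det_le_symKroneckerCoeffRect`: in characteristic zero, for `λ ⊢ m·d` with at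
  most `m²` parts, `mult_{λ*} k[Δ(det_m)] ≤ symKroneckerCoeffRect k m d λ`,

where `symKroneckerCoeffRect k m d λ : ℕ` (the rectangular symmetric Kronecker coefficient
`sk(λ, m × d) = sk^λ_{(d^m)(d^m)}`) is DEFINED as the dimension of the bound space of
`𝔖_{md}`-invariant coefficient matrices with columns in the weight space `Y_λ ≅ [λ]` and rows in the
*symmetric* Kronecker invariants `X' = ((E ⊗ F)^{⊗ md})^{B_E × B_F, τ} ≅ Sym²(HW_□) ≅ Sym²[□]`,
`□ = (d, …, d)`, i.e. `dim ([λ] ⊗ Sym²[□])^{𝔖_{md}} = dim Hom_{𝔖_{md}}([λ], Sym²[□])` (Specht modules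
are self-dual), and IDENTIFIED with BLMW's / Gesmundo–Ikenmeyer–Panova's `sk` by the proved
character formula

* `two_mul_factorial_mul_symKroneckerCoeffRect`:
  `2 · (md)! · sk(λ, m × d) = ∑_{τ ∈ 𝔖_{md}} χ^λ(τ) (χ^□(τ)² + χ^□(τ²))`

(Fulton–Harris (2.9) with Exercise 2.2, `χ_{Sym²V}(g) = ½(χ_V(g)² + χ_V(g²))`), together with
`symKroneckerCoeffRect_le_kroneckerCoeff` (`sk ≤ g`, BLMW loc. cit.) and
`finrank_boundSpace_kronInvariants` (`dim T = g(λ, □, □)` for the non-symmetric bound space).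
Over `ℂ` the right-hand side of the character formula is the tree's `skCharSum λ □`
(`Literature/Barriers/ValiantsHypothesis/GCTMatrixPowering.lean`), evaluated in the kernel by
`MNEval.skSumT` (`sum_symSq_eq_skSumT`), so `sk(λ, m × d)` is decidable on closed instances.

## Proof

With `N = m²`, `D = m d`, `χ = λ*`: §1–§3 of the sibling file give
`mult_χ k[Δ_m[f]] ≤ dim boundSpace χ X` for ANY subspace `X` containing the vectors of `W^{⊗D}`
fixed by a family `S` of elements of `GL_N` stabilising `f`
(`finrank_highestWeightSpace_orbitCoordRep_le`). Here `f = det_m` and `S` = {`a ⊗ b` : `a, b`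
upper triangular unimodular} ∪ {`swapGL`} (`IsDetSymStab`); the transposition stabilises `det_m`
(`det Xᵀ = det X`, `linSubstRep_reindexGL_swapGL_detFormLex`), and `X' = symKronInvariants`, the
swap-fixed Kronecker invariants. Splitting words (`splitFun`) identifies `X'` with the symmetric
slice functions `symSlice (HW_□)` of `SymmetricSliceCharacter` as `𝔖_D`-representations
(`symKronInvariantsEquivSymSlice`; the Kronecker invariants are the slice functions with slices in
the unimodular Borel invariants `= HW_□`, `unimodularBorelInvariants_eq_highestWeightSpace`, and
`swapGL` acts on slice functions by swapping the two variables, `splitFun_wordRep_swapGL`), whence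
`2 χ_{X'}(τ) = χ^□(τ)² + χ^□(τ²)` (`two_mul_character_symSlice`, `character_hwPermRep`), and
`D! · dim T' = ∑_τ χ^λ(τ) χ_{X'}(τ)` (`card_mul_finrank_boundSpace`,
`character_transposedPermRep_dualOfPartition`).

## References

* P. Bürgisser, J. M. Landsberg, L. Manivel, J. Weyman, SIAM J. Comput. 40(4) (2011) 1179–1209,
  doi:10.1137/090765328 = arXiv:0907.2850v3, §5.2: (5.2.5) (definition of `sk^π_{μμ}`,
  `sk^π_{μμ} ≤ k_{πμμ}`), Prop. 5.2.1 (5.2.6)–(5.2.7). [cite: BLMW2011, §5.2 Prop. 5.2.1]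
* F. Gesmundo, C. Ikenmeyer, G. Panova, *Geometric complexity theory and matrix powering*,
  Diff. Geom. Appl. 55 (2017) 106–127 = arXiv:1611.00827, §2.1 ("`ℂ[GL_{n²} det_n]_d =
  ⊕_λ V_λ^{⊕ sk(λ, n×d)}` … `sk(λ, n×d)` is the multiplicity of `[λ]` in `S²[n×d]`").
  [cite: GesmundoIkenmeyerPanova2017, §2.1]
* W. Fulton, J. Harris, *Representation Theory. A First Course*, GTM 129 (1991), §2.1 Exercise 2.2,
  §2.2 (2.9). [cite: FultonHarrisGTM129, §2.1 Exercise 2.2]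

## Design

`namespace Literature.NumberTheory.DiophantineGeometry`, next to the sibling files; everything is a
`def` with a body or a proved `theorem` (no named facts). `symKronInvariants k m D` is defined for
every `D` as the common fixed space of the family `IsDetSymStab` (so that the hypothesis `hSX` of
`finrank_highestWeightSpace_orbitCoordRep_le` is `id`), and characterised by
`mem_symKronInvariants_iff` (Kronecker invariant and swap-fixed). The highest-weight space of the
rectangle is written `highestWeightSpace (wordRep k m (m*d)) (Weight.ofPartition m □)` as in the
sibling file (it is `hwSpace k m □` of `WordModelProjection`, not imported). The transposition is
the tree's `swapGL k m` of `PowerTraceStabilizer` (Gesmundo–Ikenmeyer–Panova's `τ` for the power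
trace), so that the two orbit-closure bounds share one stabilizer vocabulary. (A summit-side file of
the ValiantsHypothesis cone, `…Theorems.ValuativeFlip`, carries its own copy of the swap and of the
inequality `mult ≤ dim T'` for its route; the identification of `dim T'` with `sk` by characters,
`sk ≤ g`, and the Literature home of the bound are this file.)
-/

noncomputable section

open MvPolynomial
open scoped BigOperators Matrix Kronecker TensorProduct

namespace Literature.NumberTheory.DiophantineGeometry

/-! ### §1 The transposition stabilises the determinant -/

section Transposition

variable (k : Type*) [Field k] (m : ℕ)

/-- **`det(Xᵀ) = det X` for the generic matrix**: renaming `X_{(i,j)} ↦ X_{(j,i)}` fixes `detPoly`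
(`Matrix.det_transpose`). BLMW 2011 §5.2 (the transposition `τ ∈ GL(E ⊗ E)` lies in the
stabilizer `H` of `det_n`). [folklore] -/
theorem rename_swap_detPoly :
    rename (Prod.swap : Fin m × Fin m → Fin m × Fin m)
        (Literature.Computability.AlgebraicComplexity.detPoly (Fin m) k) =
      Literature.Computability.AlgebraicComplexity.detPoly (Fin m) k := by
  rw [Literature.Computability.AlgebraicComplexity.detPoly, AlgHom.map_det]
  have h : (rename (Prod.swap : Fin m × Fin m → Fin m × Fin m) :
      MvPolynomial (Fin m × Fin m) k →ₐ[k] MvPolynomial (Fin m × Fin m) k).mapMatrix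
        (Matrix.mvPolynomialX (Fin m) (Fin m) k) = (Matrix.mvPolynomialX (Fin m) (Fin m) k)ᵀ := by
    refine Matrix.ext fun i j => ?_
    rw [AlgHom.mapMatrix_apply, Matrix.map_apply, Matrix.mvPolynomialX_apply, rename_X,
      Matrix.transpose_apply, Matrix.mvPolynomialX_apply, Prod.swap_prod_mk]
  rw [h, Matrix.det_transpose]

/-- **The transposition stabilises `det_m`** in the lexicographic matrix variables: the element
`swapGL` of `GL_{m²}`, reindexed to `MatIdx m`, fixes `detFormLex k m` (as
`linSubstRep_reindexGL_swapGL_powFormLex` for the power trace). BLMW 2011 §5.2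
(`H = H₀ ⋊ ℤ₂ ⊂ GL(W)(det_n)`). [cite: BLMW2011, §5.2 Prop. 5.2.1] -/
theorem linSubstRep_reindexGL_swapGL_detFormLex :
    Literature.Computability.AlgebraicComplexity.linSubstRep (MatIdx m) k
        (reindexGL (k := k) (matIdxEquiv m) (swapGL k m)) (detFormLex k m) = detFormLex k m := by
  rw [Literature.Computability.AlgebraicComplexity.linSubstRep_apply, coe_reindexGL_swapGL,
    Literature.Computability.AlgebraicComplexity.linSubst_permMatrix, detFormLex, rename_rename]
  have hfun : (⇑(swapPermLex m).symm ∘ (toLex : Fin m × Fin m → MatIdx m)) = toLex ∘ Prod.swap := by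
    funext ij
    obtain ⟨i, j⟩ := ij
    rw [Function.comp_apply, Function.comp_apply, Equiv.symm_apply_eq, Prod.swap_prod_mk]
    rfl
  rw [hfun, ← rename_rename, rename_swap_detPoly]

end Transposition

/-! ### §2 The symmetric Kronecker invariants -/

section SymInvariants

variable (k : Type*) [Field k] (m : ℕ)

/-- The stabilizing family used for the determinant: the Kronecker products `a ⊗ b` of upper
triangular unimodular matrices (`IsKronUnimodularBorel`, a subgroup of `H₀ = S(GL(E) × GL(F))`)
together with the transposition `swapGL` (generator of the `ℤ₂` in `H = H₀ ⋊ ℤ₂`). BLMW 2011 §5.2.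
[cite: BLMW2011, §5.2 Prop. 5.2.1] -/
def IsDetSymStab (h : GL (Fin (m * m)) k) : Prop :=
  IsKronUnimodularBorel k m h ∨ h = swapGL k m

/-- The **symmetric Kronecker invariants**: the vectors of `W^{⊗D}`, `W = E ⊗ F = k^{m²}`, fixed by
every element of the family `IsDetSymStab` — the Kronecker invariants (`kronInvariants`) fixed by
the transposition (`mem_symKronInvariants_iff`). They contain the `H`-invariants
`(W^{⊗D})^{GL(W)(det_m)}` of BLMW 2011 §5.2. [cite: BLMW2011, §5.2 Prop. 5.2.1] -/
def symKronInvariants (D : ℕ) : Submodule k (Word (m * m) D → k) where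
  carrier := {x | ∀ h, IsDetSymStab k m h → wordRep k (m * m) D h x = x}
  add_mem' {x y} hx hy h hh := by rw [map_add, hx h hh, hy h hh]
  zero_mem' h _ := by rw [map_zero]
  smul_mem' c {x} hx h hh := by rw [map_smul, hx h hh]

variable {k m} {D : ℕ}

/-- Membership in `symKronInvariants`: Kronecker invariant and fixed by the transposition.
[folklore] -/
theorem mem_symKronInvariants_iff (x : Word (m * m) D → k) :
    x ∈ symKronInvariants k m D ↔
      x ∈ kronInvariants k m D ∧ wordRep k (m * m) D (swapGL k m) x = x := by
  constructor
  · intro hx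
    exact ⟨mem_kronInvariants_of_forall k m x fun h hh => hx h (Or.inl hh), hx _ (Or.inr rfl)⟩
  · rintro ⟨hx, hxs⟩ h hh
    rcases hh with ⟨a, b, ha, ha1, hb, hb1, rfl⟩ | rfl
    · exact hx a b ha ha1 hb hb1
    · exact hxs

/-- The symmetric Kronecker invariants lie in the Kronecker invariants. [folklore] -/
theorem symKronInvariants_le_kronInvariants : symKronInvariants k m D ≤ kronInvariants k m D :=
  fun x hx => ((mem_symKronInvariants_iff x).mp hx).1

variable (k m) in
/-- The symmetric Kronecker invariants are stable under the permutations of the positions (which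
commute with `GL_{m²}`, `wordPerm_wordRep`). [folklore] -/
theorem wordPerm_mem_symKronInvariants (τ : Equiv.Perm (Fin D)) {x : Word (m * m) D → k}
    (hx : x ∈ symKronInvariants k m D) : wordPerm k τ x ∈ symKronInvariants k m D := by
  intro h hh
  rw [← wordPerm_wordRep, hx h hh]

variable (k m) in
/-- `𝔖_D`-stability of `symKronInvariants` in the form used by `sliceRep` /
`card_mul_finrank_boundSpace`. [folklore] -/
theorem symKronInvariants_le_comap (τ : Equiv.Perm (Fin D)) :
    symKronInvariants k m D ≤ (symKronInvariants k m D).comap (wordPermRep k (m * m) D τ) :=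
  fun _ hx => wordPerm_mem_symKronInvariants k m τ hx

variable (k m) in
/-- The representation of `𝔖_D` on the symmetric Kronecker invariants (restriction of
`wordPermRep`). [folklore] -/
def symKronInvariantsPermRep : Representation k (Equiv.Perm (Fin D)) (symKronInvariants k m D) :=
  (wordPermRep k (m * m) D).subrepresentation (symKronInvariants k m D)
    (symKronInvariants_le_comap k m)

/-- `symKronInvariantsPermRep` acts as `wordPerm` on underlying functions (unfolding lemma).
[folklore] -/
@[simp]
theorem coe_symKronInvariantsPermRep_apply (τ : Equiv.Perm (Fin D)) (x : symKronInvariants k m D) :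
    ((symKronInvariantsPermRep k m τ x : symKronInvariants k m D) : Word (m * m) D → k) =
      wordPerm k τ x :=
  rfl

/-- **The transposition swaps the two variables of the slice function**:
`splitFun (swapGL · x) (u, v) = splitFun x (v, u)`. [folklore] -/
theorem splitFun_wordRep_swapGL (x : Word (m * m) D → k) :
    splitFun k m D (wordRep k (m * m) D (swapGL k m) x) = fun p => splitFun k m D x p.swap := by
  funext p
  rw [splitFun_apply, wordRep_swapGL_apply, splitFun_apply]
  congr 1
  funext q
  simp [splitWord_symm_apply]

end SymInvariants

/-! ### §3 `symKronInvariants ≃ Sym²(HW_□)` and its character -/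

section Character

variable (k : Type*) [Field k] {m : ℕ} (d : ℕ)

/-- The highest-weight space of the rectangular weight is stable under `𝔖_D` (restated from the
sibling file in the `hY` form). [folklore] -/
theorem rectangle_le_comap (τ : Equiv.Perm (Fin (m * d))) :
    highestWeightSpace (wordRep k m (m * d)) (Weight.ofPartition m (Nat.Partition.rectangle m d)) ≤
      (highestWeightSpace (wordRep k m (m * d))
        (Weight.ofPartition m (Nat.Partition.rectangle m d))).comap (wordPermRep k m (m * d) τ) :=
  highestWeightSpace_le_comap_wordPermRep k (Weight.ofPartition m (Nat.Partition.rectangle m d)) τ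

/-- **Symmetric Kronecker invariants ≃ symmetric slice functions with slices in `HW_□`** (linear
isomorphism induced by the word splitting, characteristic zero): a Kronecker invariant has all
slices in the unimodular Borel invariants `= HW_□`
(`mem_kronInvariants_iff_slices`, `unimodularBorelInvariants_eq_highestWeightSpace`), and it is
fixed by the transposition iff its slice function is symmetric (`splitFun_wordRep_swapGL`).
BLMW 2011 §5.2 (proof of Prop. 5.2.1). [folklore] -/
def symKronInvariantsEquivSymSliceLinear [CharZero k] :
    symKronInvariants k m (m * d) ≃ₗ[k]
      symSlice (highestWeightSpace (wordRep k m (m * d))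
        (Weight.ofPartition m (Nat.Partition.rectangle m d))) where
  toFun x := ⟨splitFun k m (m * d) x, by
    have hx := (mem_symKronInvariants_iff (x : Word (m * m) (m * d) → k)).mp x.2
    have h := (mem_kronInvariants_iff_slices k (x : Word (m * m) (m * d) → k)).mp hx.1
    rw [unimodularBorelInvariants_eq_highestWeightSpace] at h
    have hs := congrArg (splitFun k m (m * d)) hx.2
    rw [splitFun_wordRep_swapGL] at hs
    exact ⟨h, fun p => congr_fun hs p⟩⟩
  invFun M := ⟨(splitFun k m (m * d)).symm M, by
    rw [mem_symKronInvariants_iff, mem_kronInvariants_iff_slices,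
      unimodularBorelInvariants_eq_highestWeightSpace, LinearEquiv.apply_symm_apply]
    refine ⟨M.2.1, (splitFun k m (m * d)).injective ?_⟩
    rw [splitFun_wordRep_swapGL, LinearEquiv.apply_symm_apply]
    funext p
    exact M.2.2 p⟩
  map_add' _ _ := rfl
  map_smul' _ _ := rfl
  left_inv x := Subtype.ext ((splitFun k m (m * d)).symm_apply_apply _)
  right_inv M := Subtype.ext ((splitFun k m (m * d)).apply_symm_apply _)

/-- **Symmetric Kronecker invariants ≃ `Sym²(HW_□)`** (the symmetric slice functions, restriction of
`pairRep wordPermRep wordPermRep`) as representations of `𝔖_{md}`, characteristic zero: the word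
splitting is `𝔖_D`-equivariant (`splitFun_wordPerm`). BLMW 2011 §5.2 ("the action of the
involution `τ` corresponds to the action of `σ^π_{δⁿδⁿ}` on `K^π_{δⁿ,δⁿ}`");
Gesmundo–Ikenmeyer–Panova §2.1 (`S²[λ]` = the `ℤ₂` invariants in `[λ] ⊗ [λ]`). [folklore] -/
def symKronInvariantsEquivSymSlice [CharZero k] :
    (symKronInvariantsPermRep k m (D := m * d)).Equiv
      ((pairRep (wordPermRep k m (m * d)) (wordPermRep k m (m * d))).subrepresentation
        (symSlice (highestWeightSpace (wordRep k m (m * d))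
          (Weight.ofPartition m (Nat.Partition.rectangle m d))))
        (symSlice_le_comap (rectangle_le_comap k d))) :=
  Representation.Equiv.mk (symKronInvariantsEquivSymSliceLinear k d) fun τ => by
    apply LinearMap.ext
    intro x
    apply Subtype.ext
    change splitFun k m (m * d) (wordPerm k τ x) =
      pairRep (wordPermRep k m (m * d)) (wordPermRep k m (m * d)) τ (splitFun k m (m * d) x)
    rw [splitFun_wordPerm, pairRep_wordPermRep_apply]

/-- **The character of the symmetric Kronecker invariants**:
`2 · χ_{X'}(τ) = χ^□(τ)² + χ^□(τ²)` for the `𝔖_{md}`-representation on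
`symKronInvariants k m (m d)` (restriction of `wordPermRep`), `□ = (d, …, d)`, characteristic zero:
`symKronInvariantsEquivSymSlice`, the symmetric-square character formula
`two_mul_character_symSlice` (Fulton–Harris §2.1 Exercise 2.2) and `HW_□ ≃ S^□`
(`character_hwPermRep`). This is `dim (S_π(E ⊗ F))^H = sk^π_{δⁿδⁿ}` of BLMW's proof of
Prop. 5.2.1 at the level of characters. [cite: BLMW2011, §5.2 Prop. 5.2.1] -/
theorem two_mul_character_symKronInvariantsPermRep [CharZero k] (τ : Equiv.Perm (Fin (m * d))) :
    2 * ((wordPermRep k (m * m) (m * d)).subrepresentation (symKronInvariants k m (m * d))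
        (symKronInvariants_le_comap k m)).character τ =
      spechtCharacter k (Nat.Partition.rectangle m d) τ ^ 2 +
        spechtCharacter k (Nat.Partition.rectangle m d) (τ * τ) := by
  have hHW := rectangle_le_comap k (m := m) d
  have hiso : ((wordPermRep k (m * m) (m * d)).subrepresentation (symKronInvariants k m (m * d))
      (symKronInvariants_le_comap k m)).character =
      ((pairRep (wordPermRep k m (m * d)) (wordPermRep k m (m * d))).subrepresentation
        (symSlice (highestWeightSpace (wordRep k m (m * d))
          (Weight.ofPartition m (Nat.Partition.rectangle m d))))
        (symSlice_le_comap hHW)).character :=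
    Representation.char_iso (symKronInvariantsEquivSymSlice k d)
  have hchar : ((wordPermRep k m (m * d)).subrepresentation
      (highestWeightSpace (wordRep k m (m * d))
        (Weight.ofPartition m (Nat.Partition.rectangle m d))) hHW).character =
      spechtCharacter k (Nat.Partition.rectangle m d) :=
    character_hwPermRep k (Nat.Partition.rectangle m d) (Nat.Partition.card_parts_rectangle_le m d)
  rw [hiso, two_mul_character_symSlice hHW τ, hchar]

end Character

/-! ### §4 The rectangular symmetric Kronecker coefficient and the bound -/

section Bound

variable (k : Type*) [Field k] (m d : ℕ)

/-- **The rectangular symmetric Kronecker coefficient `sk(λ, m × d) = sk^λ_{(d^m)(d^m)}`** of a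
partition `λ ⊢ m·d`, BLMW 2011 (5.2.5): "`sk^π_{μμ} := dim Hom_{𝔖_d}([π], Sym²[μ])` … the
multiplicity of `[π]` in the symmetric square `Sym²[μ]`", here for `μ = (d^m)`; Gesmundo–Ikenmeyer–
Panova §2.1 ("`sk(λ, n×d)` is the multiplicity of `[λ]` in `S²[n×d]`"). DEFINED in the word model
as the dimension of the bound space `T' = boundSpace λ* X'` of `𝔖_{md}`-invariant coefficient
matrices with columns in the weight space `Y_{λ*} ≅ [λ]` (`character_transposedPermRep_dualOfPartition`)
and rows in the symmetric Kronecker invariants `X' ≅ Sym²(HW_□) ≅ Sym²[□]`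
(`symKronInvariantsEquivSymSlice`), i.e. `dim ([λ] ⊗ Sym²[□])^{𝔖_{md}} = dim Hom_{𝔖_{md}}([λ], Sym²[□])`
(Specht modules being self-dual in characteristic zero); the identification with the printed
definition is the proved character formula `two_mul_factorial_mul_symKroneckerCoeffRect`
(`2·(md)!·sk = ∑_τ χ^λ(τ)(χ^□(τ)² + χ^□(τ²))`, valid for `ℓ(λ) ≤ m²`, characteristic zero; for
`ℓ(λ) > m²` or positive characteristic the value is that of the truncated weight, junk).
[cite: BLMW2011, §5.2 (5.2.5)] -/
def symKroneckerCoeffRect (lam : Nat.Partition (m * d)) : ℕ :=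
  Module.finrank k (boundSpace k (Weight.dualOfPartition (m * m) lam) (symKronInvariants k m (m * d)))

variable {m d}

/-- **Character formula for the rectangular symmetric Kronecker coefficient** (characteristic zero,
`ℓ(λ) ≤ m²`): `2 · (md)! · sk(λ, m × d) = ∑_{τ ∈ 𝔖_{md}} χ^λ(τ) (χ^□(τ)² + χ^□(τ²))`
— `(md)! · dim T' = ∑_τ χ^λ(τ) χ_{X'}(τ)` (`card_mul_finrank_boundSpace`, Fulton–Harris (2.9)) and
`2 χ_{X'}(τ) = χ^□(τ)² + χ^□(τ²)` (`two_mul_character_symKronInvariantsPermRep`, Fulton–Harris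
Exercise 2.2). Over `ℂ` the right-hand side is `skCharSum λ □` of the barrier catalogue, computed by
`MNEval.skSumT` (`sum_symSq_eq_skSumT`). [cite: FultonHarrisGTM129, §2.1 Exercise 2.2] -/
theorem two_mul_factorial_mul_symKroneckerCoeffRect [CharZero k] (lam : Nat.Partition (m * d))
    (hlam : lam.parts.card ≤ m * m) :
    ((2 * (m * d).factorial * symKroneckerCoeffRect k m d lam : ℕ) : k) =
      ∑ τ : Equiv.Perm (Fin (m * d)), spechtCharacter k lam τ *
        (spechtCharacter k (Nat.Partition.rectangle m d) τ ^ 2 +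
          spechtCharacter k (Nat.Partition.rectangle m d) (τ * τ)) := by
  have hcount : (((m * d).factorial : ℕ) : k) * (symKroneckerCoeffRect k m d lam : k) =
      ∑ τ : Equiv.Perm (Fin (m * d)), spechtCharacter k lam τ *
        ((wordPermRep k (m * m) (m * d)).subrepresentation (symKronInvariants k m (m * d))
          (symKronInvariants_le_comap k m)).character τ := by
    have h := card_mul_finrank_boundSpace k (Weight.dualOfPartition (m * m) lam)
      (symKronInvariants k m (m * d)) (symKronInvariants_le_comap k m)
    rw [Fintype.card_perm, Fintype.card_fin,
      character_transposedPermRep_dualOfPartition k lam hlam] at h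
    exact h
  push_cast
  rw [mul_assoc, hcount, Finset.mul_sum]
  refine Finset.sum_congr rfl fun τ _ => ?_
  rw [mul_left_comm, two_mul_character_symKronInvariantsPermRep k d τ]

/-- **`dim T = g(λ, □, □)`**: the dimension of the (non-symmetric) bound space with rows in the
Kronecker invariants is the rectangular Kronecker coefficient (characteristic zero, `ℓ(λ) ≤ m²`):
`(md)! · dim T = ∑_τ χ^λ(τ) χ^□(τ)² = (md)! · g(λ, □, □)` (`card_mul_finrank_boundSpace`,
`character_kronInvariantsPermRep`, `kroneckerCoeff_eq_sum_spechtCharacter_holds`); the counting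
step of `orbitMultiplicity_det_le_kroneckerCoeff_holds`, isolated. BLMW 2011 §5.2
(`dim (S_π(E ⊗ F))^{H₀} = k_{π δⁿ δⁿ}`). [cite: BLMW2011, §5.2 Prop. 5.2.1] -/
theorem finrank_boundSpace_kronInvariants [CharZero k] (lam : Nat.Partition (m * d))
    (hlam : lam.parts.card ≤ m * m) :
    Module.finrank k (boundSpace k (Weight.dualOfPartition (m * m) lam) (kronInvariants k m (m * d))) =
      kroneckerCoeff k lam (Nat.Partition.rectangle m d) (Nat.Partition.rectangle m d) := by
  have hX : ∀ τ : Equiv.Perm (Fin (m * d)), kronInvariants k m (m * d) ≤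
      (kronInvariants k m (m * d)).comap (wordPermRep k (m * m) (m * d) τ) :=
    fun τ _ hx => wordPerm_mem_kronInvariants k m τ hx
  have hcount := card_mul_finrank_boundSpace k (Weight.dualOfPartition (m * m) lam)
    (kronInvariants k m (m * d)) hX
  rw [Fintype.card_perm, Fintype.card_fin,
    character_transposedPermRep_dualOfPartition k lam hlam] at hcount
  have hchar : ((wordPermRep k (m * m) (m * d)).subrepresentation (kronInvariants k m (m * d))
      hX).character =
      spechtCharacter k (Nat.Partition.rectangle m d) * spechtCharacter k (Nat.Partition.rectangle m d) :=
    character_kronInvariantsPermRep k d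
  rw [hchar] at hcount
  have hkron := kroneckerCoeff_eq_sum_spechtCharacter_holds k lam (Nat.Partition.rectangle m d)
    (Nat.Partition.rectangle m d)
  have heq : ((Module.finrank k (boundSpace k (Weight.dualOfPartition (m * m) lam)
      (kronInvariants k m (m * d))) : ℕ) : k) =
      (kroneckerCoeff k lam (Nat.Partition.rectangle m d) (Nat.Partition.rectangle m d) : k) := by
    have hfact : (((m * d).factorial : ℕ) : k) ≠ 0 := Nat.cast_ne_zero.mpr (Nat.factorial_ne_zero _)
    apply mul_left_cancel₀ hfact
    rw [hcount, ← Nat.cast_mul, hkron]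
    refine Finset.sum_congr rfl fun τ _ => ?_
    rw [Pi.mul_apply]
    ring
  exact Nat.cast_injective heq

/-- **`sk(λ, m × d) ≤ g(λ, m × d, m × d)`** (characteristic zero, `ℓ(λ) ≤ m²`): the symmetric
bound space is contained in the non-symmetric one (`symKronInvariants ≤ kronInvariants`), whose
dimension is `g(λ, □, □)` (`finrank_boundSpace_kronInvariants`). BLMW 2011 (5.2.5):
"`sk^π_{μμ} ≤ k_{πμμ}` and the inequality may be strict". [cite: BLMW2011, §5.2 (5.2.5)] -/
theorem symKroneckerCoeffRect_le_kroneckerCoeff [CharZero k] (lam : Nat.Partition (m * d))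
    (hlam : lam.parts.card ≤ m * m) :
    symKroneckerCoeffRect k m d lam ≤
      kroneckerCoeff k lam (Nat.Partition.rectangle m d) (Nat.Partition.rectangle m d) := by
  rw [← finrank_boundSpace_kronInvariants k lam hlam]
  refine Submodule.finrank_mono fun L hL => ?_
  exact ⟨hL.1, hL.2.1, fun I => symKronInvariants_le_kronInvariants (hL.2.2 I)⟩

variable (m) in
/-- **BLMW's symmetric Kronecker bound for the determinant orbit closure (proved).** Over a field of
characteristic zero, for a partition `λ ⊢ m·d` with at most `m²` parts, the multiplicity of the
highest weight `λ* = (Weight.dualOfPartition (m*m) λ).toMatIdx` in the coordinate ring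
`k[Δ(det_m)]` of the orbit closure of the determinant (`orbitMultiplicity k (detFormLex k m) m`,
the weight pinning the degree `d`) is at most the rectangular symmetric Kronecker coefficient
`sk(λ, m × d)`: "`ℂ[\overline{GL(W)·det_n}]_δ ⊆ ⊕_{π : |π| = nδ} (S_πW^*)^{⊕ sk^π_{δⁿδⁿ}}`"
(BLMW 2011 Prop. 5.2.1, (5.2.7)), sharpening the tree's `orbitMultiplicity_det_le_kroneckerCoeff`
(`sk ≤ g`, `symKroneckerCoeffRect_le_kroneckerCoeff`). Proof: `finrank_highestWeightSpace_orbitCoordRep_le`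
with the stabilizing family `IsDetSymStab` (`linSubstRep_reindexGL_kronFin_detFormLex`,
`linSubstRep_reindexGL_swapGL_detFormLex`) and `X' = symKronInvariants`; see the module docstring.
[cite: BLMW2011, §5.2 Prop. 5.2.1] -/
theorem orbitMultiplicity_det_le_symKroneckerCoeffRect [CharZero k] (lam : Nat.Partition (m * d))
    (hlam : lam.parts.card ≤ m * m) :
    orbitMultiplicity k (detFormLex k m) m (Weight.dualOfPartition (m * m) lam).toMatIdx ≤
      symKroneckerCoeffRect k m d lam := by
  have hle := finrank_highestWeightSpace_orbitCoordRep_le (detFormLex k m) m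
    ((Weight.dualOfPartition (m * m) lam).toMatIdx : Weight (MatIdx m)) (matIdxEquiv m)
    (size_toMatIdx_dualOfPartition m lam hlam) (symKronInvariants k m (m * d)) (IsDetSymStab k m)
    (fun _ hx => hx)
    (fun h hh => by
      rcases hh with ⟨a, b, ha, ha1, hb, hb1, rfl⟩ | rfl
      · exact linSubstRep_reindexGL_kronFin_detFormLex k m ha1 hb1
      · exact linSubstRep_reindexGL_swapGL_detFormLex k m)
  rw [toMatIdx_comp_matIdxEquiv] at hle
  exact hle

end Bound

end Literature.NumberTheory.DiophantineGeometry
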